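import Summits.ABC.ABC.Theses.IsogenyGlueCongruence
import Literature.NumberTheory.EllipticCurves.SzpiroFreyCurveProofs
import Literature.NumberTheory.EllipticCurves.SzpiroOfAbcProofs
import Literature.NumberTheory.DiophantineGeometry.LocalReductionProofs
import Literature.NumberTheory.EllipticCurves.ModularCurveManinSemistableCoprimeFormProofs

/-!
# `PolyHeightOfBoundedPrimes` (stmt-ABC-16006, crux B' of route IsogenyGlueCongruence) —
the binder `[W.IsGloballyMinimal]` of the consequent is load-bearing

Negative support (refuter crux-attack seat `refuter-rattack-stmt-ABC-16006-0`, 2026-08-16).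
The consequent `H` of B' bounds `max(|Δ_W|, |c₄(W)|³)` of the Weierstrass MODEL `W` by `C · N_W^σ`.
The conductor `N_W` and semistability are isomorphism invariants (`conductorNorm_smul_rat`,
`isSemistable_smul_iff_holds`) but `Δ` scales by `u⁻¹²` under an admissible change of variables
`(u, r, s, t)`; so with the global-minimality binder dropped, the rescaled models
`(1/m, 0, 0, 0) • E₀`, `m = 1, 2, …`, of ONE semistable elliptic curve `E₀` — here the Frey curve of
`3 + 32 = 35` in Serre's normalisation, semistable by `isSemistable_freyCurve_of_mod_holds` — have a
fixed conductor and `|Δ| = m¹² · |Δ₀| → ∞`: the "scaling gauge" version of `H` is false outright.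
Consequently any proof of B' must use `[W.IsGloballyMinimal]` (which pins `W.Δ` to the minimal
discriminant, `WeierstrassCurve.cast_minimalDiscriminantInt`), and with that binder dropped the item
`A → H` collapses to `¬ A` (a refutation of crux A `DegreePrimesPolyBounded`). This answers the
refuter's "missing normalisation" attack on the item: the normalisation is present, and it is exactly
the global-minimality binder.

* `not_polyHeight_without_isGloballyMinimal` — `H` with `[W.IsGloballyMinimal]` dropped is false
  (witness family: the rescalings `(1/m, 0, 0, 0) • freyCurve 3 32`);
* `polyHeightOfBoundedPrimes_without_isGloballyMinimal_iff_not_degreePrimesPolyBounded` — with the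
  binder dropped the item is equivalent to `¬ DegreePrimesPolyBounded`;
* `polyHeight_without_isSemistable_of_generalizedSzpiroBG` — by contrast the binder
  `W.IsSemistable ℤ` is NOT needed for plausibility: `H` for all globally minimal elliptic `W/ℚ`
  follows from the catalogued `GeneralizedSzpiroConjectureBG` (mutation record for provers).
-/

noncomputable section

-- `Summit.<Summit>.<Problem>`: for the single-conjunct summit `ABC` the duplicate `ABC.ABC` is mandated.
set_option linter.dupNamespace false

open IsDedekindDomain WeierstrassCurve Literature.NumberTheory.EllipticCurves
open Summit.ABC.ABC.Theses.IsogenyGlueCongruence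

namespace Summit.ABC.ABC.Theorems.PolyHeightOfBoundedPrimes.Negative

/-- **Rescaling the Weierstrass model.** For the admissible change of variables
`(u, r, s, t) = (1/m, 0, 0, 0)` over `ℚ` (`m ≠ 0`), `Δ((1/m, 0, 0, 0) • W) = m¹² · Δ(W)`.
Silverman AEC III.1, Table 3.1. [folklore] -/
theorem rescale_Δ (W : WeierstrassCurve ℚ) (m : ℕ) (hm : (m : ℚ) ≠ 0) :
    ((⟨Units.mk0 ((m : ℚ)⁻¹) (inv_ne_zero hm), 0, 0, 0⟩ : VariableChange ℚ) • W).Δ =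
      (m : ℚ) ^ 12 * W.Δ := by
  rw [variableChange_Δ]
  congr 1
  simp

/-- The base curve of the witness family, the Frey curve `y² = x (x − 3) (x + 32)` of the triple
`3 + 32 = 35` (Serre's normalisation `a ≡ −1 (mod 4)`, `32 ∣ b`), is elliptic (`3 · 32 · 35 ≠ 0`).
[folklore] -/
theorem isElliptic_freyCurve_three : (freyCurve 3 32).IsElliptic := isElliptic_freyCurve (by norm_num)

/-- The base curve `freyCurve 3 32` is semistable (Serre's normalisation; tree theorem
`isSemistable_freyCurve_of_mod_holds`, Diamond–Kramer 1995). [folklore] -/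
theorem isSemistable_freyCurve_three : (freyCurve 3 32).IsSemistable ℤ :=
  isSemistable_freyCurve_of_mod_holds 3 32 ⟨11, -1, by norm_num⟩ (by norm_num) (by decide) dvd_rfl

/-- **`H` without global minimality is false.** For the rescalings `W_m = (1/m, 0, 0, 0) • E₀` of the
semistable base curve `E₀ = freyCurve 3 32`: `N_{W_m} = N_{E₀}` (`conductorNorm_smul_rat`), `W_m` is
semistable (`isSemistable_smul_iff_holds`) and elliptic, while `|Δ(W_m)| = m¹² |Δ(E₀)|` is
unbounded; so no `σ, C` bound `max(|Δ|, |c₄|³) ≤ C · N^σ` over all (non-minimal) semistable models.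
[folklore] -/
theorem not_polyHeight_without_isGloballyMinimal :
    ¬ (∃ σ C : ℝ, ∀ (W : WeierstrassCurve ℚ) [W.IsElliptic] [NeZero (W.conductorNorm ℤ)],
      W.IsSemistable ℤ → ((max |W.Δ| (|W.c₄| ^ 3) : ℚ) : ℝ) ≤ C * (W.conductorNorm ℤ : ℝ) ^ σ) := by
  rintro ⟨σ, C, h⟩
  haveI : (freyCurve 3 32).IsElliptic := isElliptic_freyCurve_three
  have hΔ₀ : 0 < |((freyCurve 3 32).Δ : ℝ)| := by
    rw [abs_pos]
    exact_mod_cast (isUnit_Δ (W := freyCurve 3 32)).ne_zero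
  set K : ℝ := C * (((freyCurve 3 32).conductorNorm ℤ : ℕ) : ℝ) ^ σ with hK
  have key : ∀ m : ℕ, 0 < m → (m : ℝ) ^ 12 * |((freyCurve 3 32).Δ : ℝ)| ≤ K := by
    intro m hm
    have hm' : (m : ℚ) ≠ 0 := by exact_mod_cast hm.ne'
    set u : VariableChange ℚ := ⟨Units.mk0 ((m : ℚ)⁻¹) (inv_ne_zero hm'), 0, 0, 0⟩ with hu
    haveI : NeZero ((u • freyCurve 3 32).conductorNorm ℤ) :=
      ⟨((u • freyCurve 3 32).conductorNorm_pos_holds).ne'⟩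
    have hS : (u • freyCurve 3 32).IsSemistable ℤ :=
      (isSemistable_smul_iff_holds ℤ (freyCurve 3 32) u).mpr isSemistable_freyCurve_three
    have hh := h (u • freyCurve 3 32) hS
    rw [conductorNorm_smul_rat (freyCurve 3 32) u, hu, rescale_Δ (freyCurve 3 32) m hm'] at hh
    have hle : (((|(m : ℚ) ^ 12 * (freyCurve 3 32).Δ|) : ℚ) : ℝ) ≤ K :=
      le_trans (by exact_mod_cast le_max_left _ _) hh
    have heq : (((|(m : ℚ) ^ 12 * (freyCurve 3 32).Δ|) : ℚ) : ℝ) =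
        (m : ℝ) ^ 12 * |((freyCurve 3 32).Δ : ℝ)| := by
      push_cast
      rw [abs_mul, abs_pow, Nat.abs_cast]
    rwa [heq] at hle
  obtain ⟨m, hm⟩ := exists_nat_gt (K / |((freyCurve 3 32).Δ : ℝ)|)
  have h1 := key (m + 1) (Nat.succ_pos m)
  have h2 : K / |((freyCurve 3 32).Δ : ℝ)| < ((m + 1 : ℕ) : ℝ) :=
    hm.trans (by exact_mod_cast Nat.lt_succ_self m)
  have h3 : ((m + 1 : ℕ) : ℝ) ≤ ((m + 1 : ℕ) : ℝ) ^ 12 :=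
    le_self_pow₀ (by exact_mod_cast Nat.succ_le_succ (Nat.zero_le m)) (by norm_num)
  rw [div_lt_iff₀ hΔ₀] at h2
  nlinarith [h1, h2, h3, hΔ₀, mul_le_mul_of_nonneg_right h3 hΔ₀.le]

/-- **With the minimality binder dropped, the item collapses to `¬ A`.** The implication
`DegreePrimesPolyBounded → (H without [W.IsGloballyMinimal])` holds iff crux A is false; so the
binder is load-bearing for B' and cannot be weakened away. [folklore] -/
theorem polyHeightOfBoundedPrimes_without_isGloballyMinimal_iff_not_degreePrimesPolyBounded :
    (DegreePrimesPolyBounded →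
      (∃ σ C : ℝ, ∀ (W : WeierstrassCurve ℚ) [W.IsElliptic] [NeZero (W.conductorNorm ℤ)],
        W.IsSemistable ℤ → ((max |W.Δ| (|W.c₄| ^ 3) : ℚ) : ℝ) ≤ C * (W.conductorNorm ℤ : ℝ) ^ σ)) ↔
      ¬ DegreePrimesPolyBounded :=
  ⟨fun h hA ↦ not_polyHeight_without_isGloballyMinimal (h hA), fun h hA ↦ (h hA).elim⟩

/-! ## Mutation record: semistability is not needed for plausibility -/

/-- **Dropping `W.IsSemistable ℤ` is harmless for TRUTH.** The consequent `H` of B' stated for ALL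
globally minimal elliptic `W/ℚ` (no semistability) follows from the catalogued
`GeneralizedSzpiroConjectureBG` (`max(|Δ|, |c₄|³) ≤ C(ε)·N^{6+ε}` on integral global minimal models;
`@[conjecture]`, equivalent to the `≤`-form of abc by `abcLe_iff_generalizedSzpiroBG_holds`) with
`σ = 7` — the tree proof of `polyHeight_of_generalizedSzpiroBG` (p111354) never touches its
semistability hypothesis, and is repeated here without it. So that binder restricts the CLAIM (it is
what makes B' ↔ B over the Manin facts), not its plausibility; whereas `[W.IsGloballyMinimal]`
cannot be dropped (`not_polyHeight_without_isGloballyMinimal`).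
[cite: BombieriGubler2006, Conj. 12.5.11 (p. 431)] -/
theorem polyHeight_without_isSemistable_of_generalizedSzpiroBG (h : GeneralizedSzpiroConjectureBG) :
    ∃ σ C : ℝ, ∀ (W : WeierstrassCurve ℚ) [W.IsElliptic] [W.IsGloballyMinimal]
      [NeZero (W.conductorNorm ℤ)],
      ((max |W.Δ| (|W.c₄| ^ 3) : ℚ) : ℝ) ≤ C * (W.conductorNorm ℤ : ℝ) ^ σ := by
  obtain ⟨C, hC⟩ := h 1 one_pos
  refine ⟨6 + 1, C, fun W _ _ _ ↦ ?_⟩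
  set W₀ : WeierstrassCurve ℤ := integralModelInt W with hW₀def
  have hW₀ : W₀.baseChange ℚ = W := baseChange_integralModelInt W
  have hell : (W₀.baseChange ℚ).IsElliptic := by rw [hW₀]; infer_instance
  have hmin : ∀ v : HeightOneSpectrum ℤ, (W₀.baseChange ℚ).IsMinimalAt v := fun v ↦ by
    rw [hW₀]; exact IsGloballyMinimal.isMinimalAt_int W v
  have hσ := hC W₀ hell hmin
  rw [hW₀] at hσ
  have hq : (max |W.Δ| (|W.c₄| ^ 3) : ℚ) = ((max |W₀.Δ| (|W₀.c₄| ^ 3) : ℤ) : ℚ) := by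
    rw [← cast_integralModelInt_Δ W, ← cast_integralModelInt_c₄ W]
    push_cast
    rfl
  rw [hq, Rat.cast_intCast]
  exact hσ

end Summit.ABC.ABC.Theorems.PolyHeightOfBoundedPrimes.Negative

end
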